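import Literature.NumberTheory.Transcendental.PseudoExpSEACChain
import Literature.NumberTheory.Transcendental.SEACQuasiminimalChart
import HarnessLib

/-!
# Zilber's existence theorem: discharge of `exists_isZilberField_of_aleph0_lt`

B. Zilber, *Pseudo-exponentiation on algebraically closed fields of characteristic zero*, Ann. Pure
Appl. Logic 132 (2005) 67–95, Thm 1.1 (existence half; Bays–Kirby 2018, Thm 1.2): for every
uncountable cardinal `κ` there is a Zilber field of cardinality `κ`. The named fact
`Literature.NumberTheory.Transcendental.exists_isZilberField_of_aleph0_lt` of `ZilberField.lean` is
proved here by composing the two halves of the printed proof, both in the tree: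

* the countable pseudo-exponential field (Zilber 2005 §5; Kirby 2013 FPEF, Thm 6.2; Bays–Kirby
  2018, Thm 5.9) — `PseudoExpChain.exists_countable_pseudoExpField` (`PseudoExpSEACChain.lean`):
  a countable algebraically closed exponential field with surjective `exp`, standard kernel, the
  Schanuel property, strong exponential-algebraic closedness and infinite `ecl`-dimension,
  realised inside `ℂ` by the ω-chain of ELA- and SEAC-steps;
* Zilber's theorem from one such countable model (Bays–Kirby 2018: Thm 6.9 ⟹ Fact 6.4 / Kirby
  2010 Thm 4.2 ⟹ Thm 8.2 ⟹ Thm 9.1) — `exists_isZilberField_of_aleph0_lt_of_countable`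
  (`SEACQuasiminimalChart.lean`, with `ZilberFieldExistenceChart.lean`, `KappaAxioms.lean`,
  `ZilberFieldExistenceProofs.lean`).

## References

* B. Zilber, Ann. Pure Appl. Logic 132 (2005) 67–95, Thm 1.1.
* M. Bays, J. Kirby, Algebra & Number Theory 12 (2018) 493–549, Thm 1.2, Thm 5.9, Thm 6.9,
  Thm 8.2, Thm 9.1.
* J. Kirby, Algebra & Number Theory 7 (2013) 943–980, Thm 6.2.
-/

noncomputable section

open Literature.ModelTheory.ExponentialFields Literature.ModelTheory.ExponentialFields.ExponentialRing

namespace Literature.NumberTheory.Transcendental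

/-- **Zilber's existence theorem** (Zilber 2005, Thm 1.1; Bays–Kirby 2018, Thm 1.2): there are
Zilber fields of every uncountable cardinality — discharge of the named fact
`exists_isZilberField_of_aleph0_lt`, from the countable pseudo-exponential field
(`PseudoExpChain.exists_countable_pseudoExpField`) and the passage from one countable model to all
uncountable cardinalities (`exists_isZilberField_of_aleph0_lt_of_countable`).
[cite: Zilber2005PseudoExp, Thm 1.1] [cite: BaysKirby2018ANT, Thm 1.2 (= Thm 9.1 with Thm 8.2)] -/
theorem exists_isZilberField_of_aleph0_lt_holds : exists_isZilberField_of_aleph0_lt := by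
  obtain ⟨M, _, _, _, τ, hcount, hac, hsurj, hτ, hker, -, hSP, hSEAC, -, hinf⟩ :=
    PseudoExpChain.exists_countable_pseudoExpField
  haveI := hcount
  haveI := hac
  exact exists_isZilberField_of_aleph0_lt_of_countable hsurj ⟨τ, hτ, hker⟩ hSP hSEAC hinf

end Literature.NumberTheory.Transcendental
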